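import Mathlib.NumberTheory.Padics.ProperSpace
import Mathlib.NumberTheory.Padics.RingHoms
import Mathlib.MeasureTheory.Measure.Haar.Unique
import Mathlib.MeasureTheory.Constructions.BorelSpace.Basic
import Mathlib.MeasureTheory.Measure.Prod
import HarnessLib

/-!
# The normalised Haar measure on `ℤ_p` (the `p`-adic density `μ_p`)

The additive group of `p`-adic integers `ℤ_p` is a compact, second countable topological group;
its Haar measure normalised to total mass `1` is the "`p`-adic density" / "additive measure `μ_p`
normalized so that `μ_p(ℤ_p) = 1`" of arithmetic statistics (e.g. Bhargava–Shankar, Ann. of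
Math. 181 (2015), §2.5: "we normalize the additive measure `μ_p` on `V_{ℤ_p}` so that
`μ_p(V_{ℤ_p}) = 1`"; §5.2, eq. (28): "the measure `dI dJ` is normalized so that `ℤ_p × ℤ_p` has
measure `1`"). Mathlib (at the pinned revision) has the general Haar measure
(`MeasureTheory.Measure.addHaarMeasure`) and the topology of `ℤ_[p]` (`PadicInt.compactSpace`,
`Mathlib.NumberTheory.Padics.ProperSpace`) but no measure-space structure on `ℤ_[p]`; this file
supplies it and computes the measure of residue classes.

## Contents (all proved)

* `instMeasurableSpacePadicInt`, `instBorelSpacePadicInt`: the Borel σ-algebra on `ℤ_[p]`.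
* `instMeasureSpacePadicInt`: `volume := addHaarMeasure ⊤`, the Haar measure with
  `volume univ = 1` (`padicInt_volume_univ`); instances `IsProbabilityMeasure`,
  `IsAddHaarMeasure`.
* `padicInt_volume_closedBall`: every closed ball of radius `p⁻ⁿ` — i.e. every residue class
  `a + pⁿℤ_p` — has measure `p⁻ⁿ`; `padicInt_volume_setOf_norm_le`, `padicInt_volume_span_pow`
  (`μ_p(pⁿℤ_p) = p⁻ⁿ`), `padicInt_volume_setOf_pow_dvd`.
* `padicInt_volume_singleton`, and the instance `NullSingletonClass volume` (points are null).
* Products `ℤ_[p] × ℤ_[p]` (and finite products) then carry the product probability measure by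
  Mathlib's generic instances (`MeasureTheory.Measure.prod`); `padicInt_volume_prod_univ`.

Proof of the ball computation: the `pⁿ` balls `B(k, p⁻ⁿ)`, `0 ≤ k < pⁿ`, are pairwise disjoint
(two distinct naturals `< pⁿ` are not congruent mod `pⁿ`) and cover `ℤ_p` (`PadicInt.appr`);
they are translates of one another, hence have equal Haar measure, which is therefore `p⁻ⁿ`.

## References

Folklore (Haar 1933; Weil 1940). For the normalisation in use: M. Bhargava, A. Shankar,
Ann. of Math. (2) 181 (2015) 191–242, §2.5 and eq. (28). [folklore]

## Design

The instances are global instances on the Mathlib type `ℤ_[p]` (there is none upstream to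
conflict with); they are the canonical choices (`borel`, Haar probability measure), exactly as
Mathlib equips `ℝ` or `AddCircle`. Declarations live in the path namespace
`Literature.MeasureTheory.Group` and are prefixed `padicInt_` rather than placed in Mathlib's
`PadicInt` namespace.
-/

noncomputable section

open MeasureTheory TopologicalSpace Metric Set Filter
open scoped ENNReal Topology

namespace Literature.MeasureTheory.Group

variable {p : ℕ} [Fact p.Prime]

/-! ## The measure-space structure -/

/-- The Borel σ-algebra on `ℤ_p`. [folklore] -/
instance instMeasurableSpacePadicInt : MeasurableSpace ℤ_[p] := borel _

/-- `ℤ_p` with its Borel σ-algebra is a Borel space (by definition). [folklore] -/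
instance instBorelSpacePadicInt : BorelSpace ℤ_[p] := ⟨rfl⟩

/-- The normalised Haar measure on the compact group `ℤ_p`: `volume := addHaarMeasure ⊤`, the
additive Haar measure giving the (positive, compact) whole space measure `1`
(Bhargava–Shankar 2015, §2.5: "`μ_p` normalized so that `μ_p(V_{ℤ_p}) = 1`"). [folklore] -/
instance instMeasureSpacePadicInt : MeasureSpace ℤ_[p] := ⟨Measure.addHaarMeasure ⊤⟩

/-- Unfolding the definition of `volume` on `ℤ_p`. [folklore] -/
theorem padicInt_volume_eq : (volume : Measure ℤ_[p]) = Measure.addHaarMeasure ⊤ := rfl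

/-- The normalisation `μ_p(ℤ_p) = 1`. [folklore] -/
@[simp] theorem padicInt_volume_univ : volume (univ : Set ℤ_[p]) = 1 := by
  have h := Measure.addHaarMeasure_self (G := ℤ_[p]) (K₀ := ⊤)
  rw [padicInt_volume_eq]
  simpa using h

/-- `μ_p` is a probability measure. [folklore] -/
instance instIsProbabilityMeasurePadicInt : IsProbabilityMeasure (volume : Measure ℤ_[p]) :=
  ⟨padicInt_volume_univ⟩

/-- `μ_p` is an additive Haar measure (translation invariant, finite on compacts, positive on
opens). [folklore] -/
instance instIsAddHaarMeasurePadicInt : (volume : Measure ℤ_[p]).IsAddHaarMeasure := by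
  rw [padicInt_volume_eq]; infer_instance

/-- `μ_p(ℤ_p × ℤ_p) = 1` for the product measure (Bhargava–Shankar 2015, eq. (28): "`dI dJ` is
normalized so that `ℤ_p × ℤ_p` has measure `1`"). [folklore] -/
theorem padicInt_volume_prod_univ : volume (univ : Set (ℤ_[p] × ℤ_[p])) = 1 := by simp

/-! ## Residue classes -/

/-- A closed ball is the translate of the closed ball at `0`:
`B(a, r) = (x ↦ −a + x)⁻¹ B(0, r)`. [folklore] -/
theorem padicInt_closedBall_eq_preimage (a : ℤ_[p]) (r : ℝ) :
    closedBall a r = (fun x ↦ -a + x) ⁻¹' closedBall 0 r := by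
  ext x
  simp only [mem_closedBall, dist_eq_norm, mem_preimage, sub_zero]
  rw [neg_add_eq_sub]

/-- Translation invariance: all closed balls of the same radius have the same measure. [folklore] -/
theorem padicInt_volume_closedBall_eq (a : ℤ_[p]) (r : ℝ) :
    volume (closedBall a r) = volume (closedBall (0 : ℤ_[p]) r) := by
  rw [padicInt_closedBall_eq_preimage a r]
  exact measure_preimage_add _ _ _

/-- For integers `k`, `‖k‖_p ≤ p⁻ⁿ` iff `pⁿ ∣ k` (Mathlib `PadicInt.norm_int_le_pow_iff_dvd`, cast
to naturals). [folklore] -/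
theorem padicInt_norm_natCast_sub_natCast_le_iff (k l n : ℕ) :
    ‖((k : ℤ_[p]) - (l : ℤ_[p]))‖ ≤ (p : ℝ) ^ (-(n : ℤ)) ↔ ((p : ℤ) ^ n) ∣ (k : ℤ) - l := by
  have h := PadicInt.norm_int_le_pow_iff_dvd (p := p) (k := (k : ℤ) - l) (n := n)
  push_cast at h
  exact h

/-- Two distinct naturals `< pⁿ` have disjoint balls of radius `p⁻ⁿ` (they are incongruent
mod `pⁿ`, and the metric is an ultrametric). [folklore] -/
theorem padicInt_disjoint_closedBall_natCast {n k l : ℕ} (hk : k < p ^ n) (hl : l < p ^ n)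
    (hkl : k ≠ l) :
    Disjoint (closedBall ((k : ℕ) : ℤ_[p]) ((p : ℝ) ^ (-(n : ℤ))))
      (closedBall ((l : ℕ) : ℤ_[p]) ((p : ℝ) ^ (-(n : ℤ)))) := by
  rw [Set.disjoint_left]
  intro x hxk hxl
  rw [mem_closedBall, dist_eq_norm] at hxk hxl
  have hkl' : ‖((k : ℤ_[p]) - (l : ℤ_[p]))‖ ≤ (p : ℝ) ^ (-(n : ℤ)) := by
    have : (k : ℤ_[p]) - l = (x - l) + (-(x - k)) := by ring
    rw [this]
    refine le_trans (PadicInt.nonarchimedean _ _) (max_le hxl ?_)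
    rwa [norm_neg]
  rw [padicInt_norm_natCast_sub_natCast_le_iff] at hkl'
  have hk' : (k : ℤ) < (p : ℤ) ^ n := by exact_mod_cast hk
  have hl' : (l : ℤ) < (p : ℤ) ^ n := by exact_mod_cast hl
  have hlt : |(k : ℤ) - l| < (p : ℤ) ^ n := by
    rw [abs_lt]; constructor <;> omega
  have h0 : (k : ℤ) - l = 0 := Int.eq_zero_of_abs_lt_dvd hkl' hlt
  exact hkl (by exact_mod_cast sub_eq_zero.mp h0)

/-- The balls `B(k, p⁻ⁿ)`, `0 ≤ k < pⁿ`, cover `ℤ_p`: every `x` is within `p⁻ⁿ` of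
`PadicInt.appr x n`. [folklore] -/
theorem padicInt_iUnion_closedBall_natCast (n : ℕ) :
    ⋃ k : Fin (p ^ n), closedBall (((k : ℕ) : ℕ) : ℤ_[p]) ((p : ℝ) ^ (-(n : ℤ))) = univ := by
  refine eq_univ_of_forall fun x ↦ mem_iUnion.mpr ⟨⟨PadicInt.appr x n, PadicInt.appr_lt x n⟩, ?_⟩
  rw [mem_closedBall, dist_eq_norm, PadicInt.norm_le_pow_iff_mem_span_pow]
  exact PadicInt.appr_spec n x

/-- **Every residue class mod `pⁿ` has density `p⁻ⁿ`**: `μ_p(B(a, p⁻ⁿ)) = p⁻ⁿ` for every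
`a ∈ ℤ_p` (the `pⁿ` classes are disjoint translates covering `ℤ_p`, of total measure `1`). [folklore] -/
theorem padicInt_volume_closedBall (a : ℤ_[p]) (n : ℕ) :
    volume (closedBall a ((p : ℝ) ^ (-(n : ℤ)))) = ((p : ℝ≥0∞) ^ n)⁻¹ := by
  rw [padicInt_volume_closedBall_eq]
  -- total measure 1 = sum of the p^n equal pieces
  have hsum : volume (⋃ k : Fin (p ^ n), closedBall (((k : ℕ) : ℕ) : ℤ_[p]) ((p : ℝ) ^ (-(n : ℤ))))
      = ∑' k : Fin (p ^ n), volume (closedBall (((k : ℕ) : ℕ) : ℤ_[p]) ((p : ℝ) ^ (-(n : ℤ)))) := by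
    refine measure_iUnion ?_ fun k ↦ measurableSet_closedBall
    intro k l hkl
    exact padicInt_disjoint_closedBall_natCast k.2 l.2 (fun h ↦ hkl (Fin.ext h))
  rw [padicInt_iUnion_closedBall_natCast, padicInt_volume_univ, tsum_fintype] at hsum
  simp_rw [padicInt_volume_closedBall_eq _ ((p : ℝ) ^ (-(n : ℤ)))] at hsum
  rw [Finset.sum_const, Finset.card_univ, Fintype.card_fin, nsmul_eq_mul] at hsum
  -- hsum : 1 = (p^n : ℝ≥0∞) * v
  have h := ENNReal.eq_inv_of_mul_eq_one_left
    (a := volume (closedBall (0 : ℤ_[p]) ((p : ℝ) ^ (-(n : ℤ))))) (b := ((p ^ n : ℕ) : ℝ≥0∞))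
    (by rw [mul_comm]; exact hsum.symm)
  rw [h]
  push_cast
  rfl

/-- `μ_p({x : ‖x‖ ≤ p⁻ⁿ}) = p⁻ⁿ`. [folklore] -/
theorem padicInt_volume_setOf_norm_le (n : ℕ) :
    volume {x : ℤ_[p] | ‖x‖ ≤ (p : ℝ) ^ (-(n : ℤ))} = ((p : ℝ≥0∞) ^ n)⁻¹ := by
  have h := padicInt_volume_closedBall (0 : ℤ_[p]) n
  have hset : closedBall (0 : ℤ_[p]) ((p : ℝ) ^ (-(n : ℤ))) = {x : ℤ_[p] | ‖x‖ ≤ (p : ℝ) ^ (-(n : ℤ))} := by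
    ext x; simp [mem_closedBall, dist_eq_norm]
  rwa [hset] at h

/-- `μ_p(pⁿℤ_p) = p⁻ⁿ` (the ideal `(pⁿ)` as a subset). [folklore] -/
theorem padicInt_volume_span_pow (n : ℕ) :
    volume ((Ideal.span {(p : ℤ_[p]) ^ n} : Ideal ℤ_[p]) : Set ℤ_[p]) = ((p : ℝ≥0∞) ^ n)⁻¹ := by
  rw [← padicInt_volume_setOf_norm_le n]
  congr 1
  ext x
  simp only [SetLike.mem_coe, mem_setOf_eq]
  exact (PadicInt.norm_le_pow_iff_mem_span_pow x n).symm

/-- `μ_p({x : pⁿ ∣ x}) = p⁻ⁿ`. [folklore] -/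
theorem padicInt_volume_setOf_pow_dvd (n : ℕ) :
    volume {x : ℤ_[p] | (p : ℤ_[p]) ^ n ∣ x} = ((p : ℝ≥0∞) ^ n)⁻¹ := by
  rw [← padicInt_volume_span_pow n]
  congr 1
  ext x
  simp only [mem_setOf_eq, SetLike.mem_coe, Ideal.mem_span_singleton]

/-- The sets `{x : pⁿ ∣ x}` are measurable (closed balls). [folklore] -/
theorem padicInt_measurableSet_setOf_pow_dvd (n : ℕ) :
    MeasurableSet {x : ℤ_[p] | (p : ℤ_[p]) ^ n ∣ x} := by
  have hset : {x : ℤ_[p] | (p : ℤ_[p]) ^ n ∣ x} = closedBall (0 : ℤ_[p]) ((p : ℝ) ^ (-(n : ℤ))) := by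
    ext x
    simp only [mem_setOf_eq, mem_closedBall, dist_zero_right]
    rw [PadicInt.norm_le_pow_iff_mem_span_pow, Ideal.mem_span_singleton]
  rw [hset]
  exact measurableSet_closedBall

/-! ## Points are null -/

/-- Points of `ℤ_p` have Haar measure `0` (a point lies in balls of measure `p⁻ⁿ` for all `n`). [folklore] -/
theorem padicInt_volume_singleton (a : ℤ_[p]) : volume ({a} : Set ℤ_[p]) = 0 := by
  have hp : 1 < p := (Fact.out : p.Prime).one_lt
  have hle : ∀ n : ℕ, volume ({a} : Set ℤ_[p]) ≤ ((p : ℝ≥0∞) ^ n)⁻¹ := fun n ↦ by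
    rw [← padicInt_volume_closedBall a n]
    exact measure_mono (singleton_subset_iff.mpr (mem_closedBall_self (by positivity)))
  refine nonpos_iff_eq_zero.mp ?_
  refine ENNReal.le_of_forall_pos_le_add fun ε hε _ ↦ ?_
  rw [zero_add]
  obtain ⟨n, hn⟩ := ENNReal.exists_inv_nat_lt (ne_of_gt (ENNReal.coe_pos.mpr hε))
  have hpn : (n : ℝ≥0∞) ≤ (p : ℝ≥0∞) ^ n := by
    exact_mod_cast (Nat.lt_pow_self hp).le
  calc volume ({a} : Set ℤ_[p]) ≤ ((p : ℝ≥0∞) ^ n)⁻¹ := hle n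
    _ ≤ (n : ℝ≥0∞)⁻¹ := ENNReal.inv_le_inv.mpr hpn
    _ ≤ ε := hn.le

/-- `μ_p` has no atoms: singletons are null. [folklore] -/
instance instNullSingletonClassPadicInt : NullSingletonClass (volume : Measure ℤ_[p]) :=
  ⟨padicInt_volume_singleton⟩

end Literature.MeasureTheory.Group

end
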